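import Summits.BirchSwinnertonDyer.BirchSwinnertonDyer.Theorems.ManinLocalTwoThreeShimuraQuotientSquareClasses
import HarnessLib

/-!
# The rank-one instance `N = 4pq`, `p ≡ 3 (mod 4)`: every unit of `ℤ/2pq` is `± u₀^k s²`, so the Shimura quotient has ≤ 2 classes and the
# period class is a Kronecker symbol (levels `60, 84, 132, 140, 156, 204, 220, 228, 276, 308, …`)
Summit `BirchSwinnertonDyer`, route `ManinLocalTwoThree` (cell bsd-f2-manin), deciding crux C2 `ManinOddAtFour` (stmt-BirchSwinnertonDyer-22967);
lead p1 gen 15.  Number-theoretic instance for `…ShimuraQuotientSquareClasses`: with `p, q` distinct odd primes and `p ≡ 3 (mod 4)`, the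
group `((ℤ/2pq)ˣ/{±1}) ⊗ 𝔽₂` has rank `1` — the non-residue class mod `p` is absorbed by `−1` (a non-residue mod `p`), so with `u₀ ↔ (1, 1, n_q)`
(`n_q` a non-residue mod `q`) every unit is `± u₀^k s²`.
* `isSquare_or_isSquare_mul` (finite field of odd characteristic: `a` or `a·n` is a square when `n` is not);
* **`exists_generator_sq_two_mul_mul`** — the «`± u₀^k s²`» structure of `(ℤ/2pq)ˣ`;
* **`exists_jacobiSym_represents_four_mul_mul_of_isNewform0`** — for every newform on `Γ₀(4pq)` (`p ≡ 3 (mod 4)`, `q` an odd prime `≠ p`):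
  the period class is `(q′ | d_γ)` for one admissible squarefree `q′ ∣ 4pq` (`…SquareClasses` + `…TwoCharOfPeriods`);
* `exists_forall_mem_or_sub_mem_four_mul_mul` — at most two Shimura classes there (so index `4` is excluded for lattice-optimal data by
  `…LevelInstances.not_index_four_of_two_classes`, not restated).
HONEST FRAMING: unconditional structure; C2, Manin's conjecture and BSD are NOT proved.  No definitions, no sorry.
[cite: LingOesterle1991, §1, Thm. 1 and Thm. 6] [cite: Stevens1989, §2]
-/

set_option autoImplicit false
-- the summit-side namespace `Summit.BirchSwinnertonDyer.BirchSwinnertonDyer.…` is the tree's (summit = sub-problem)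
set_option linter.dupNamespace false

noncomputable section

open scoped MatrixGroups ModularForm NumberTheorySymbols

open CongruenceSubgroup Literature.NumberTheory.EllipticCurves
  Literature.NumberTheory.EllipticCurves.ModularForms

namespace Summit.BirchSwinnertonDyer.BirchSwinnertonDyer.Theorems.ManinLocalTwoThree

/-- In a finite field of odd characteristic, if `n` is a non-square then for every `a ≠ 0` either `a` or `a·n` is a square. [folklore] -/
theorem isSquare_or_isSquare_mul {F : Type*} [Field F] [Fintype F] [DecidableEq F]
    {n : F} (hn : ¬ IsSquare n) {a : F} (ha : a ≠ 0) : IsSquare a ∨ IsSquare (a * n) := by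
  have hn0 : n ≠ 0 := by rintro rfl; exact hn ⟨0, by simp⟩
  rcases quadraticChar_dichotomy ha with h | h
  · exact Or.inl ((quadraticChar_one_iff_isSquare ha).mp h)
  · right
    apply (quadraticChar_one_iff_isSquare (mul_ne_zero ha hn0)).mp
    rw [map_mul, h, (quadraticChar_neg_one_iff_not_isSquare.mpr hn)]; norm_num

/-- **`(ℤ/2pq)ˣ = {± u₀^k s²}` for distinct odd primes `p ≡ 3 (mod 4)` and `q`.** [folklore] -/
theorem exists_generator_sq_two_mul_mul {p q : ℕ} (hp : p.Prime) (hq : q.Prime) (hp2 : p ≠ 2) (hq2 : q ≠ 2)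
    (hpq : p ≠ q) (hp3 : p % 4 = 3) :
    ∃ u₀ : ZMod (2 * (p * q)), IsUnit u₀ ∧ ∀ w : (ZMod (2 * (p * q)))ˣ, ∃ (k : ℕ) (s : (ZMod (2 * (p * q)))ˣ),
      (w : ZMod (2 * (p * q))) = u₀ ^ k * (s : ZMod (2 * (p * q))) ^ 2 ∨
        (w : ZMod (2 * (p * q))) = -(u₀ ^ k * (s : ZMod (2 * (p * q))) ^ 2) := by
  haveI : Fact p.Prime := ⟨hp⟩
  haveI : Fact q.Prime := ⟨hq⟩
  have hcpq : Nat.Coprime p q := (Nat.coprime_primes hp hq).mpr hpq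
  have hc2 : Nat.Coprime 2 (p * q) :=
    Nat.Coprime.mul_right ((Nat.coprime_primes Nat.prime_two hp).mpr (Ne.symm hp2))
      ((Nat.coprime_primes Nat.prime_two hq).mpr (Ne.symm hq2))
  let E : ZMod (2 * (p * q)) ≃+* ZMod 2 × (ZMod p × ZMod q) :=
    (ZMod.chineseRemainder hc2).trans (RingEquiv.prodCongr (RingEquiv.refl _) (ZMod.chineseRemainder hcpq))
  -- non-residues: `−1 (mod p)` and some `n (mod q)`
  have hneg1 : ¬ IsSquare (-1 : ZMod p) := by rw [ZMod.exists_sq_eq_neg_one_iff]; exact fun h ↦ h hp3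
  have hFq : ringChar (ZMod q) ≠ 2 := by rw [ZMod.ringChar_zmod_n]; exact hq2
  obtain ⟨n, hn⟩ := FiniteField.exists_nonsquare hFq
  have hn0 : n ≠ 0 := by rintro rfl; exact hn ⟨0, by simp⟩
  refine ⟨E.symm (1, (1, n)), ?_, fun w ↦ ?_⟩
  · have : IsUnit ((1, (1, n)) : ZMod 2 × (ZMod p × ZMod q)) :=
      Prod.isUnit_iff.mpr ⟨isUnit_one, Prod.isUnit_iff.mpr ⟨isUnit_one, hn0.isUnit⟩⟩
    exact this.map E.symm
  -- components of `w`
  have hwu : IsUnit (E (w : ZMod (2 * (p * q)))) := (Units.isUnit w).map E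
  set w₂ := (E (w : ZMod (2 * (p * q)))).1 with hw₂
  set wp := (E (w : ZMod (2 * (p * q)))).2.1 with hwp
  set wq := (E (w : ZMod (2 * (p * q)))).2.2 with hwq
  have hEw : E (w : ZMod (2 * (p * q))) = (w₂, (wp, wq)) := rfl
  rw [hEw, Prod.isUnit_iff, Prod.isUnit_iff] at hwu
  obtain ⟨hu2, hup, huq⟩ := hwu
  have hw₂1 : w₂ = 1 := by
    have key : ∀ x : ZMod 2, x ≠ 0 → x = 1 := by decide
    exact key _ hu2.ne_zero
  have hwp0 : wp ≠ 0 := hup.ne_zero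
  have hwq0 : wq ≠ 0 := huq.ne_zero
  -- sign `ε` making `ε·wp` a square mod `p`
  obtain ⟨ε, hε, sp, hsp⟩ : ∃ ε : ℤ, (ε = 1 ∨ ε = -1) ∧ ∃ sp : ZMod p, (ε : ZMod p) * wp = sp * sp := by
    rcases isSquare_or_isSquare_mul hneg1 hwp0 with ⟨r, hr⟩ | ⟨r, hr⟩
    · exact ⟨1, Or.inl rfl, r, by push_cast; rw [one_mul]; exact hr⟩
    · exact ⟨-1, Or.inr rfl, r, by push_cast; rw [← hr]; ring⟩
  have hεq0 : ((ε : ZMod q)) * wq ≠ 0 := by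
    rcases hε with rfl | rfl <;> push_cast <;> simpa using hwq0
  -- `k` making `ε·wq·n^{-k}`… : `ε wq` or `ε wq n` is a square mod `q`
  obtain ⟨k, hk1, sq, hsq⟩ : ∃ k : ℕ, k ≤ 1 ∧ ∃ sq : ZMod q, (ε : ZMod q) * wq = n ^ k * (sq * sq) := by
    rcases isSquare_or_isSquare_mul hn hεq0 with ⟨r, hr⟩ | ⟨r, hr⟩
    · exact ⟨0, zero_le_one, r, by rw [pow_zero, one_mul]; exact hr⟩
    · refine ⟨1, le_rfl, r * n⁻¹, ?_⟩
      rw [pow_one]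
      have : (ε : ZMod q) * wq = ((ε : ZMod q) * wq * n) * n⁻¹ := by field_simp
      rw [this, hr]; field_simp
  -- the square root `s ↔ (1, sp, sq)`; it is a unit
  have hsp0 : sp ≠ 0 := by
    intro h0; rw [h0, mul_zero] at hsp
    rcases hε with rfl | rfl <;> push_cast at hsp <;> simp [hwp0] at hsp
  have hsq0 : sq ≠ 0 := by
    intro h0; rw [h0, mul_zero, mul_zero] at hsq; exact hεq0 hsq
  have hsU : IsUnit ((1, (sp, sq)) : ZMod 2 × (ZMod p × ZMod q)) :=
    Prod.isUnit_iff.mpr ⟨isUnit_one, Prod.isUnit_iff.mpr ⟨hsp0.isUnit, hsq0.isUnit⟩⟩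
  obtain ⟨s, hs⟩ := (hsU.map E.symm)
  refine ⟨k, s, ?_⟩
  -- compare both sides through `E`
  have hε2 : (ε : ZMod 2) = 1 := by rcases hε with rfl | rfl <;> decide
  have hεsq : ((ε : ℤ) : ZMod (2 * (p * q))) * (ε : ZMod (2 * (p * q))) = 1 := by
    rcases hε with rfl | rfl <;> push_cast <;> norm_num
  have target : (w : ZMod (2 * (p * q))) = (ε : ZMod (2 * (p * q))) * ((E.symm (1, (1, n))) ^ k * (s : ZMod (2 * (p * q))) ^ 2) := by
    apply E.injective
    rw [map_mul, map_mul, map_pow, map_pow, hs, RingEquiv.apply_symm_apply, RingEquiv.apply_symm_apply, map_intCast, hEw,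
      hw₂1]
    ext
    · simp [hε2]
    · show wp = (ε : ZMod p) * (1 ^ k * sp ^ 2)
      have hεp : (ε : ZMod p) * (ε : ZMod p) = 1 := by rcases hε with rfl | rfl <;> push_cast <;> norm_num
      calc wp = ((ε : ZMod p) * (ε : ZMod p)) * wp := by rw [hεp, one_mul]
        _ = (ε : ZMod p) * ((ε : ZMod p) * wp) := by ring
        _ = (ε : ZMod p) * (1 ^ k * sp ^ 2) := by rw [hsp]; ring
    · show wq = (ε : ZMod q) * (n ^ k * sq ^ 2)
      have hεq : (ε : ZMod q) * (ε : ZMod q) = 1 := by rcases hε with rfl | rfl <;> push_cast <;> norm_num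
      calc wq = ((ε : ZMod q) * (ε : ZMod q)) * wq := by rw [hεq, one_mul]
        _ = (ε : ZMod q) * ((ε : ZMod q) * wq) := by ring
        _ = (ε : ZMod q) * (n ^ k * sq ^ 2) := by rw [hsq]; ring
  rcases hε with rfl | rfl
  · left; rw [target]; push_cast; ring
  · right; rw [target]; push_cast; ring

variable {N : ℕ} [NeZero N] (f : CuspForm (Gamma0 N) 2)

/-- **At `N = 4pq` (`p ≡ 3 (mod 4)`, `p, q` distinct odd primes) the Shimura quotient of every newform has at most two classes.**
(`u = 2`, `v = pq`, `uv = 2pq`.) [cite: LingOesterle1991, §1, Thm. 1 and Thm. 6] -/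
theorem exists_forall_mem_or_sub_mem_four_mul_mul {p q : ℕ} (hp : p.Prime) (hq : q.Prime) (hp2 : p ≠ 2) (hq2 : q ≠ 2)
    (hpq : p ≠ q) (hp3 : p % 4 = 3) (hN : N = 4 * p * q) (hf : IsNewform0 f) :
    ∃ γ₀ : Gamma0 N, ∀ z ∈ periodLattice f,
      z ∈ periodLatticeGamma1 f ∨ z - cuspSymbol f γ₀ ∈ periodLatticeGamma1 f := by
  obtain ⟨u₀, hu₀, hgen⟩ := exists_generator_sq_two_mul_mul hp hq hp2 hq2 hpq hp3
  have hNZ : (N : ℤ) = (2 : ℤ) ^ 2 * (p * q : ℕ) := by rw [hN]; push_cast; ring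
  have h4 : 2 ^ 2 ∣ N := ⟨p * q, by rw [hN]; ring⟩
  have h2Λ : ∀ z ∈ periodLattice f, (2 : ℂ) * z ∈ periodLatticeGamma1 f := fun z hz ↦ by
    have h := pMulLatticeLeGamma1OfTracelessPrime_holds N f hf 2 Nat.prime_two
      ((dvd_pow_self 2 two_ne_zero).trans h4) (hf.cuspCoeff_eq_zero_of_sq_dvd Nat.prime_two h4) z hz
    exact_mod_cast h
  exact exists_forall_mem_or_sub_mem_periodLatticeGamma1_of_generator_sq_mod f (u := 2) (v := p * q) two_ne_zero hNZ hu₀ hgen h2Λ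

/-- **At `N = 4pq` (`p ≡ 3 (mod 4)`): the period class of every newform is a Kronecker symbol `(q′ | d_γ)`** for one admissible squarefree
`q′ ∣ N`. [cite: LingOesterle1991, §1, Thm. 1 and Thm. 6] [cite: Stevens1989, §2] -/
theorem exists_jacobiSym_represents_four_mul_mul_of_isNewform0 {p q : ℕ} (hp : p.Prime) (hq : q.Prime) (hp2 : p ≠ 2)
    (hq2 : q ≠ 2) (hpq : p ≠ q) (hp3 : p % 4 = 3) (hN : N = 4 * p * q) (hf : IsNewform0 f) :
    ∃ q' : ℕ, Squarefree q' ∧ q' ∣ N ∧ (¬ 32 ∣ N → Odd q') ∧ (¬ 8 ∣ N → q' % 4 = 1) ∧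
      ∀ γ : Gamma0 N, cuspSymbol f γ ∈ periodLatticeGamma1 f ↔ J(q' | (((γ : SL(2, ℤ)) 1 1 : ℤ)).natAbs) = 1 := by
  obtain ⟨u₀, hu₀, hgen⟩ := exists_generator_sq_two_mul_mul hp hq hp2 hq2 hpq hp3
  have hNZ : (N : ℤ) = (2 : ℤ) ^ 2 * (p * q : ℕ) := by rw [hN]; push_cast; ring
  have h4 : 4 ∣ N := ⟨p * q, by rw [hN]; ring⟩
  exact exists_jacobiSym_represents_of_generator_sq_mod_of_isNewform0 f (u := 2) (v := p * q) two_ne_zero hNZ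
    rfl hu₀ hgen hf h4

end Summit.BirchSwinnertonDyer.BirchSwinnertonDyer.Theorems.ManinLocalTwoThree

end
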